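import Summits.RiemannHypothesis.RiemannHypothesis.Theorems.SuzukiThetaFlowDecay
import Literature.NumberTheory.LFunctions.WeilCriterionProofs

/-!
# SuzukiThetaFlowScale — where the θ-flow chain is unconditional and where it is RH re-indexed (column DBR; bookkeeping)

LINE 1 — LABEL: RH-FREE implications recording the SCALE of the chain `theta-flow-weil-window` after
`Theorems.SuzukiThetaFlow.thetaFlowDecay`: the decay law and the coercivity `outputsCoercive` hold for EVERY window `t > 0`
unconditionally; the monotonicity (T1) `NormSqAntitone t` is UNCONDITIONAL for `0 < t ≤ 1` (`normSqAntitone_of_le_one`, Weil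
input = the tree theorem `weilPositivityOn_one`) and, at the `∀ t` level, an RH-CONSEQUENCE (this file: `RiemannHypothesis →
∀ t ≥ 0, NormSqAntitone t`, through the tree's Weil criterion `weil_criterion_holds : RH ↔ WeilPositivity`).  bears_on:
B-P(P2-flow).  WHAT THIS IS NOT: not a proof of any instance beyond `t ≤ 1`, not a converse (`∀ t, NormSqAntitone t → RH` is
NOT claimed — it would need density of the window outputs in Weil's form domain), not evidence for or against RH; nothing here
is progress toward RH.
-/

noncomputable section

-- D-0017: `Summit.<S>.<S>.…` is the designed namespace of a single-problem summit.
set_option linter.dupNamespace false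

open MeasureTheory Set

namespace Summit.RiemannHypothesis.RiemannHypothesis.Theorems.SuzukiThetaFlow

open Literature.NumberTheory.LFunctions

/-- RH-FREE (trivial restriction).  Weil positivity on all tests gives Weil positivity on every window. -/
theorem weilPositivityOn_of_weilPositivity (h : WeilPositivity) (a : ℝ) : WeilPositivityOn a :=
  fun g hg _ => h g hg

/-- RH-FREE implication · **(T1) on EVERY window from Weil positivity** (`WeilPositivity` is RH-EQUIVALENT by
`weil_criterion_holds`; this is the `∀ t` level of the card, an implication — nothing is claimed about its hypothesis). -/
theorem normSqAntitone_of_weilPositivity (h : WeilPositivity) (t : ℝ) (ht : 0 ≤ t) : NormSqAntitone t :=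
  weilWindowAntitone t ht (weilPositivityOn_of_weilPositivity h t)

/-- RH-CONSEQUENCE · **under RH, Suzuki's window norms `‖𝖪_θ[t]f‖` are θ-antitone on `(1,∞)` for EVERY window `t ≥ 0`**
(`weil_criterion_holds.1` + the decay law).  The `t ≤ 1` instances are unconditional (`normSqAntitone_of_le_one`); the rest is
Weil's criterion re-indexed.  Nothing here bears on the truth of RH. -/
theorem normSqAntitone_of_riemannHypothesis (hRH : RiemannHypothesis) (t : ℝ) (ht : 0 ≤ t) : NormSqAntitone t :=
  normSqAntitone_of_weilPositivity (weil_criterion_holds.1 hRH) t ht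

/-- RH-CONSEQUENCE · under RH an anchor at `θ₀ > 1` on `[0,T]` gives the θ-uniform clean window `∀ θ ≥ θ₀, CleanUpTo θ T`
for EVERY `T` (unconditionally only for `T ≤ 1`: `uniformCleanWindow_of_anchor`).  Nothing here bears on the truth of RH. -/
theorem uniformCleanWindow_of_anchor_of_riemannHypothesis (hRH : RiemannHypothesis) {θ₀ T : ℝ} (hθ₀ : 1 < θ₀)
    (h : Anchor θ₀ T) : UniformCleanWindow θ₀ T :=
  uniformCleanWindow_of_antitone_anchor hθ₀ (fun t ht0 _ => normSqAntitone_of_riemannHypothesis hRH t ht0) h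
    contractionExcludes

/-- RH-FREE · **THE SCALE OF THE CHAIN, in one statement**: (i) the decay law holds on every window (theorem); (ii) (T1) holds
unconditionally on every window `0 < t ≤ 1`; (iii) `RH → (T1)` on every window `t ≥ 0`.  Nothing here bears on RH. -/
theorem thetaFlow_scale_summary :
    ThetaFlowDecay ∧ (∀ t : ℝ, 0 < t → t ≤ 1 → NormSqAntitone t) ∧
      (RiemannHypothesis → ∀ t : ℝ, 0 ≤ t → NormSqAntitone t) :=
  ⟨thetaFlowDecay, fun _ ht ht1 => normSqAntitone_of_le_one ht ht1, fun hRH t ht => normSqAntitone_of_riemannHypothesis hRH t ht⟩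

end Summit.RiemannHypothesis.RiemannHypothesis.Theorems.SuzukiThetaFlow

end
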